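import Summits.Ventures.PercRepro.ProfilePointedMirror
import Summits.Ventures.PercRepro.ProfilePointedCircuitClassesThreeCocircuitB
import Summits.Ventures.PercRepro.ProfileGapMonoThresholdDeletionCount

/-!
# PercRepro — THE PER-POINT FORM OF THEOREM A AT `n = 10`, PART A: THE CIRCUIT TRACE AND THE PARALLEL CLASS
(p5, gen 49; `proofs/P5-GM1.md` §73)

For a point `x` and a set `W` the CIRCUIT TRACE `circTrace N x W := {y ∈ W : x ∉ cl(W − y)}` is, when `W` is
independent and `x ∈ cl W`, the fundamental circuit of `x` in `W` with `x` removed.  Two submodularity facts drive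
the `n = 10` proof: (SUB) if `x ∈ cl(W − w)` for every `w ∈ S ⊆ W` then `x ∈ cl(W ∖ S)`, and (EXT) adding a point
`z ∉ cl W` to `W` does not change the trace.  The PARALLEL CLASS (trace `{y}`, i.e. `x ∥ y`) is handled here in full:
the bi-independent sets of `N` through `y` are, after removing `y`, the bi-independent sets of the eight-point minor
`N ／ y ∖ x` one level down, and Theorem A's step at nullity `3` (`biIndep_step_three_of_nullity_three`, kernel)
gives `in_4(y) ≤ in_5(y)` on every ten-point matroid of rank `6`.  Part B runs the local LYM on the classes of
trace size `≥ 2` and assembles `out_4(x) ≤ in_5(x)`.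
-/

open scoped Matroid

namespace PercRepro.Cogirth

open Finset ThmH Skew Shadow Profile

variable {α : Type} [DecidableEq α] {N : Matroid α} [N.Finite]

section TenPointedA

/-- The circuit trace of `x` in `W`: the points `y ∈ W` with `x ∉ cl(W − y)`. -/
noncomputable def circTrace (N : Matroid α) [N.Finite] (x : α) (W : Finset α) : Finset α :=
  W.filter (fun y => x ∉ clF N (W.erase y))

/-- Membership in the circuit trace. -/
theorem mem_circTrace {x y : α} {W : Finset α} :
    y ∈ circTrace N x W ↔ y ∈ W ∧ x ∉ clF N (W.erase y) := by
  unfold circTrace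
  exact mem_filter

/-- The circuit trace lies in `W`. -/
theorem circTrace_subset (x : α) (W : Finset α) : circTrace N x W ⊆ W := filter_subset _ _

/-- **(SUB)**: if `x ∈ cl(W − w)` for every `w ∈ S ⊆ W` (`W` independent, `x ∈ cl W`) then `x ∈ cl(W ∖ S)` —
two subsets of `W` with union `W` that both capture `x` have an intersection capturing `x` (submodularity),
iterated over `S`. -/
theorem mem_clF_sdiff_of_forall_mem_clF_erase {x : α} (hx : x ∈ gr N) {W : Finset α} (hW : W ⊆ gr N)
    (hWi : rk N W = W.card) (hxW : x ∈ clF N W) {S : Finset α} (hS : S ⊆ W)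
    (h : ∀ w ∈ S, x ∈ clF N (W.erase w)) : x ∈ clF N (W \ S) := by
  induction S using Finset.induction_on with
  | empty => simpa using hxW
  | @insert s T hsT ih =>
    have hT : T ⊆ W := (subset_insert s T).trans hS
    have hsW : s ∈ W := hS (mem_insert_self s T)
    have ih' := ih hT (fun w hw => h w (mem_insert_of_mem hw))
    have hs := h s (mem_insert_self s T)
    have hAB : W \ T ∪ W.erase s = W := by
      ext w
      simp only [mem_union, mem_sdiff, mem_erase]
      constructor
      · rintro (⟨hw, _⟩ | ⟨_, hw⟩) <;> exact hw
      · intro hw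
        by_cases hwT : w ∈ T
        · exact Or.inr ⟨fun hws => hsT (hws ▸ hwT), hw⟩
        · exact Or.inl ⟨hw, hwT⟩
    have hAB' : W \ T ∩ W.erase s = W \ insert s T := by
      ext w
      simp only [mem_inter, mem_sdiff, mem_erase, mem_insert, not_or]
      tauto
    have hA : W \ T ⊆ gr N := sdiff_subset.trans hW
    have hB : W.erase s ⊆ gr N := (erase_subset s W).trans hW
    have hC : W \ insert s T ⊆ gr N := sdiff_subset.trans hW
    have hcT : T.card + 1 ≤ W.card := by
      have := card_le_card hS
      rwa [card_insert_of_notMem hsT] at this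
    have hrA : rk N (W \ T) = W.card - T.card := by
      rw [rk_eq_card_of_subset_of_rk_eq_card sdiff_subset hWi, card_sdiff_of_subset hT]
    have hrB : rk N (W.erase s) = W.card - 1 := by
      rw [rk_eq_card_of_subset_of_rk_eq_card (erase_subset s W) hWi, card_erase_of_mem hsW]
    have hrC : rk N (W \ insert s T) = W.card - (T.card + 1) := by
      rw [rk_eq_card_of_subset_of_rk_eq_card sdiff_subset hWi, card_sdiff_of_subset hS,
        card_insert_of_notMem hsT]
    have hxA := (mem_clF_iff_rk_insert_eq hx hA).1 ih'
    have hxB := (mem_clF_iff_rk_insert_eq hx hB).1 hs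
    have hxW' := (mem_clF_iff_rk_insert_eq hx hW).1 hxW
    have hsub := rk_union_add_rk_inter_le (M := N) (insert x (W \ T)) (insert x (W.erase s))
    have hu : insert x (W \ T) ∪ insert x (W.erase s) = insert x W := by
      rw [← insert_union_distrib, hAB]
    have hi : insert x (W \ T) ∩ insert x (W.erase s) = insert x (W \ insert s T) := by
      rw [← insert_inter_distrib, hAB']
    rw [hu, hi, hxA, hxB, hxW', hrA, hrB] at hsub
    have hmono := rk_mono' (M := N) (subset_insert x (W \ insert s T))
    rw [mem_clF_iff_rk_insert_eq hx hC]
    omega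

/-- **(EXT)**: if `W` is independent, `x ∈ cl W`, `z ∉ cl W` and `x ∉ cl(W − w)` for some `w ∈ W`, then still
`x ∉ cl(W − w + z)` (submodularity on `W − w + z + x` and `W + x`). -/
theorem notMem_clF_insert_erase_of_notMem_clF {x z w : α} (hx : x ∈ gr N) (hz : z ∈ gr N) {W : Finset α}
    (hW : W ⊆ gr N) (hWi : rk N W = W.card) (hxW : x ∈ clF N W) (hzW : z ∉ clF N W) (hw : w ∈ W)
    (hxw : x ∉ clF N (W.erase w)) : x ∉ clF N (insert z (W.erase w)) := by
  intro hcon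
  have hzW' : z ∉ W := fun h => hzW (subset_clF_self_of_subset_gr hW h)
  have hA : insert z (W.erase w) ⊆ gr N := insert_subset hz ((erase_subset w W).trans hW)
  have hB : W.erase w ⊆ gr N := (erase_subset w W).trans hW
  have hzW2 : insert z W ⊆ gr N := insert_subset hz hW
  have hu : insert x (insert z (W.erase w)) ∪ insert x W = insert x (insert z W) := by
    rw [← insert_union_distrib]
    congr 1
    ext y
    simp only [mem_union, mem_insert, mem_erase]
    constructor
    · rintro ((h | ⟨_, h⟩) | h)
      · exact Or.inl h
      · exact Or.inr h
      · exact Or.inr h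
    · rintro (h | h)
      · exact Or.inl (Or.inl h)
      · exact Or.inr h
  have hi : insert x (insert z (W.erase w)) ∩ insert x W = insert x (W.erase w) := by
    rw [← insert_inter_distrib]
    congr 1
    ext y
    simp only [mem_inter, mem_insert, mem_erase]
    constructor
    · rintro ⟨h | ⟨h1, h2⟩, h3⟩
      · exact absurd (h ▸ h3) hzW'
      · exact ⟨h1, h2⟩
    · rintro ⟨h1, h2⟩
      exact ⟨Or.inr ⟨h1, h2⟩, h2⟩
  have hsub := rk_union_add_rk_inter_le (M := N) (insert x (insert z (W.erase w))) (insert x W)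
  rw [hu, hi] at hsub
  have h1 : rk N (insert x (insert z W)) = rk N (insert z W) :=
    (mem_clF_iff_rk_insert_eq hx hzW2).1 (clF_mono (M := N) (subset_insert z W) hxW)
  have h2 : rk N (insert z W) = rk N W + 1 := rk_insert_eq_add_one_of_notMem_clF hz hW hzW
  have h3 : rk N (insert x (W.erase w)) = rk N (W.erase w) + 1 :=
    rk_insert_eq_add_one_of_notMem_clF hx hB hxw
  have h4 : rk N (W.erase w) = W.card - 1 := by
    rw [rk_eq_card_of_subset_of_rk_eq_card (erase_subset w W) hWi, card_erase_of_mem hw]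
  have h5 : rk N (insert x (insert z (W.erase w))) = rk N (insert z (W.erase w)) :=
    (mem_clF_iff_rk_insert_eq hx hA).1 hcon
  have h6 : rk N (insert z (W.erase w)) ≤ W.card := by
    have := rk_le_card (M := N) (insert z (W.erase w))
    have hc : (insert z (W.erase w)).card = W.card := by
      rw [card_insert_of_notMem (fun h => hzW' (mem_of_mem_erase h)), card_erase_of_mem hw]
      have := card_pos.2 ⟨w, hw⟩
      omega
    omega
  have h7 : rk N (insert x W) = rk N W := (mem_clF_iff_rk_insert_eq hx hW).1 hxW
  have hpos : 0 < W.card := card_pos.2 ⟨w, hw⟩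
  omega

/-- **THE TRACE IS PRESERVED BY EXTENSION**: for `W` independent with `x ∈ cl W` and `z ∉ cl W`,
`circTrace (W + z) = circTrace W`. -/
theorem circTrace_insert_eq {x z : α} (hx : x ∈ gr N) (hz : z ∈ gr N) {W : Finset α} (hW : W ⊆ gr N)
    (hWi : rk N W = W.card) (hxW : x ∈ clF N W) (hzW : z ∉ clF N W) :
    circTrace N x (insert z W) = circTrace N x W := by
  have hzW' : z ∉ W := fun h => hzW (subset_clF_self_of_subset_gr hW h)
  ext y
  rw [mem_circTrace, mem_circTrace, mem_insert]
  constructor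
  · rintro ⟨hy | hy, hcl⟩
    · subst hy
      rw [erase_insert hzW'] at hcl
      exact absurd hxW hcl
    · refine ⟨hy, fun hcon => hcl ?_⟩
      have hyz : y ≠ z := fun h => hzW' (h ▸ hy)
      rw [erase_insert_of_ne hyz.symm]
      exact clF_mono (M := N) (subset_insert z (W.erase y)) hcon
  · rintro ⟨hy, hcl⟩
    have hyz : y ≠ z := fun h => hzW' (h ▸ hy)
    refine ⟨Or.inr hy, ?_⟩
    rw [erase_insert_of_ne hyz.symm]
    exact notMem_clF_insert_erase_of_notMem_clF hx hz hW hWi hxW hzW hy hcl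

/-! ### Parallel points -/

/-- A non-loop `x` in the closure of `{y}` has `y` in the closure of `{x}`. -/
theorem mem_clF_singleton_symm {x y : α} (hx : x ∈ gr N) (hy : y ∈ gr N) (hx1 : rk N {x} = 1)
    (h : x ∈ clF N {y}) : y ∈ clF N {x} := by
  have h1 := (mem_clF_iff_rk_insert_eq hx (singleton_subset_iff.2 hy)).1 h
  rw [mem_clF_iff_rk_insert_eq hy (singleton_subset_iff.2 hx), pair_comm, h1, hx1]
  have h2 := rk_mono' (M := N) (singleton_subset_iff.2 (mem_insert_self x {y}))
  have h3 := rk_le_card (M := N) {y}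
  rw [card_singleton] at h3
  omega

/-- Parallel points are interchangeable in ranks: `ρ(Z + x) = ρ(Z + y)` when `x ∈ cl{y}` and `y ∈ cl{x}`. -/
theorem rk_insert_eq_rk_insert_of_parallel {x y : α} (hx : x ∈ gr N) (hy : y ∈ gr N) (hxy : x ∈ clF N {y})
    (hyx : y ∈ clF N {x}) {Z : Finset α} (hZ : Z ⊆ gr N) :
    rk N (insert x Z) = rk N (insert y Z) := by
  have h1 : rk N (insert y (insert x Z)) = rk N (insert x Z) :=
    (mem_clF_iff_rk_insert_eq hy (insert_subset hx hZ)).1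
      (clF_mono (M := N) (singleton_subset_iff.2 (mem_insert_self x Z)) hyx)
  have h2 : rk N (insert x (insert y Z)) = rk N (insert y Z) :=
    (mem_clF_iff_rk_insert_eq hx (insert_subset hy hZ)).1
      (clF_mono (M := N) (singleton_subset_iff.2 (mem_insert_self y Z)) hxy)
  rw [← h1, insert_comm, h2]

/-- A non-loop `x` parallel to `y` lies in no independent set containing `y`. -/
theorem notMem_of_mem_of_parallel {x y : α} (hx : x ∈ gr N) (hy : y ∈ gr N) (hxy' : x ≠ y) (hxy : x ∈ clF N {y})
    {W : Finset α} (hWi : rk N W = W.card) (hyW : y ∈ W) : x ∉ W := by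
  intro hxW
  have hsub : ({x, y} : Finset α) ⊆ W := by
    intro z hz
    rw [mem_insert, mem_singleton] at hz
    rcases hz with rfl | rfl
    · exact hxW
    · exact hyW
  have h1 := rk_eq_card_of_subset_of_rk_eq_card hsub hWi
  rw [card_pair hxy'] at h1
  have h2 := (mem_clF_iff_rk_insert_eq hx (singleton_subset_iff.2 hy)).1 hxy
  have h3 := rk_le_card (M := N) {y}
  rw [card_singleton] at h3
  omega

/-! ### The parallel class: `in_4(y) ≤ in_5(y)` for `y ∥ x` on ten points of rank six -/

/-- The ground set of `N ／ y ∖ x` with `y` put back is `E − x`. -/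
theorem insert_gr_minor_eq {x y : α} (hy : y ∈ gr N) (hxy : x ≠ y) :
    insert y (gr ((N ／ ({y} : Set α)) ＼ ({x} : Set α))) = (gr N).erase x := by
  rw [gr_minor_eq, erase_right_comm, insert_erase (mem_erase.2 ⟨hxy.symm, hy⟩)]

/-- **THE DEMANDS THROUGH `y` ARE THE BI-INDEPENDENT `3`-SETS OF `N ／ y ∖ x`** (`x ∥ y`; the injection
`W ↦ W − y`): `in_4(y) ≤ P_3(N ／ y ∖ x)`. -/
theorem inCount_four_le_biIndep_three_minor_of_parallel {x y : α} (hx : x ∈ gr N)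
    (hy : y ∈ gr N) (hxy : x ≠ y) (hpar : x ∈ clF N {y}) (hpar' : y ∈ clF N {x}) (hy1 : rk N {y} = 1) :
    inCount N 4 y ≤ (biIndepSets ((N ／ ({y} : Set α)) ＼ ({x} : Set α)) 3).card := by
  unfold inCount
  apply card_le_card_of_injOn (fun W => W.erase y)
  · intro W hW
    rw [mem_coe, mem_filter, mem_biIndepSets] at hW
    obtain ⟨⟨hWg, hWc, hWr, hWc'⟩, hyW⟩ := hW
    have hxW : x ∉ W := notMem_of_mem_of_parallel hx hy hxy hpar hWr hyW
    have hgr := gr_minor_eq (N := N) y x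
    have hsub : W.erase y ⊆ gr ((N ／ ({y} : Set α)) ＼ ({x} : Set α)) := by
      rw [hgr]
      intro z hz
      rw [mem_erase] at hz
      exact mem_erase.2 ⟨fun h => hxW (h ▸ hz.2), mem_erase.2 ⟨hz.1, hWg hz.2⟩⟩
    rw [mem_coe, mem_biIndepSets]
    beta_reduce
    refine ⟨hsub, ?_, ?_, ?_⟩
    · rw [card_erase_of_mem hyW, hWc]
    · have h1 := rk_minor_add_one (N := N) (x := y) (w := x) hy1 hsub
      rw [insert_erase hyW, hWr, hWc] at h1
      rw [card_erase_of_mem hyW, hWc]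
      omega
    · have hcompl : gr ((N ／ ({y} : Set α)) ＼ ({x} : Set α)) \ W.erase y = (gr N \ W).erase x := by
        rw [hgr]
        ext z
        simp only [mem_sdiff, mem_erase]
        constructor
        · rintro ⟨⟨hzx, hzy, hzg⟩, hz⟩
          exact ⟨hzx, hzg, fun hzW => hz ⟨hzy, hzW⟩⟩
        · rintro ⟨hzx, hzg, hzW⟩
          exact ⟨⟨hzx, fun hzy => hzW (hzy ▸ hyW), hzg⟩, fun h => hzW h.2⟩
      rw [hcompl]
      have hxc : x ∈ gr N \ W := mem_sdiff.2 ⟨hx, hxW⟩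
      have hsub' : (gr N \ W).erase x ⊆ gr ((N ／ ({y} : Set α)) ＼ ({x} : Set α)) := by
        rw [← hcompl]; exact sdiff_subset
      have h1 := rk_minor_add_one (N := N) (x := y) (w := x) hy1 hsub'
      have h2 : rk N (insert y ((gr N \ W).erase x)) = rk N (insert x ((gr N \ W).erase x)) :=
        (rk_insert_eq_rk_insert_of_parallel hx hy hpar hpar' ((erase_subset x _).trans sdiff_subset)).symm
      rw [h2, insert_erase hxc, hWc'] at h1
      rw [card_erase_of_mem hxc]
      omega
  · intro W hW W' hW' hWW'
    rw [mem_coe, mem_filter] at hW hW'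
    have h : W.erase y = W'.erase y := hWW'
    rw [← insert_erase hW.2, ← insert_erase hW'.2, h]

/-- **THE BI-INDEPENDENT `4`-SETS OF `N ／ y ∖ x` ARE UNITS THROUGH `y`** (`x ∥ y`; the injection `U ↦ U + y`):
`P_4(N ／ y ∖ x) ≤ in_5(y)`. -/
theorem biIndep_four_minor_le_inCount_five_of_parallel {x y : α} (hx : x ∈ gr N)
    (hy : y ∈ gr N) (hxy : x ≠ y) (hpar : x ∈ clF N {y}) (hpar' : y ∈ clF N {x}) (hy1 : rk N {y} = 1) :
    (biIndepSets ((N ／ ({y} : Set α)) ＼ ({x} : Set α)) 4).card ≤ inCount N 5 y := by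
  unfold inCount
  have hgr := gr_minor_eq (N := N) y x
  apply card_le_card_of_injOn (fun U => insert y U)
  · intro U hU
    rw [mem_coe, mem_biIndepSets] at hU
    obtain ⟨hUg, hUc, hUr, hUc'⟩ := hU
    have hyU : y ∉ U := by
      intro h
      have := hUg h
      rw [hgr, mem_erase, mem_erase] at this
      exact this.2.1 rfl
    have hxU : x ∉ U := by
      intro h
      have := hUg h
      rw [hgr, mem_erase] at this
      exact this.1 rfl
    have hUg' : U ⊆ gr N := by
      intro z hz
      have := hUg hz
      rw [hgr, mem_erase, mem_erase] at this
      exact this.2.2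
    rw [mem_coe, mem_filter, mem_biIndepSets]
    beta_reduce
    refine ⟨⟨insert_subset hy hUg', ?_, ?_, ?_⟩, mem_insert_self y U⟩
    · rw [card_insert_of_notMem hyU, hUc]
    · have h1 := rk_minor_add_one (N := N) (x := y) (w := x) hy1 hUg
      rw [card_insert_of_notMem hyU, hUc]
      omega
    · have hcompl : gr N \ insert y U = insert x (gr ((N ／ ({y} : Set α)) ＼ ({x} : Set α)) \ U) := by
        rw [hgr]
        ext z
        simp only [mem_sdiff, mem_insert, mem_erase]
        constructor
        · rintro ⟨hzg, hz⟩
          rw [not_or] at hz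
          by_cases hzx : z = x
          · exact Or.inl hzx
          · exact Or.inr ⟨⟨hzx, hz.1, hzg⟩, hz.2⟩
        · rintro (rfl | ⟨⟨_, hzy, hzg⟩, hzU⟩)
          · exact ⟨hx, by rw [not_or]; exact ⟨hxy, hxU⟩⟩
          · exact ⟨hzg, by rw [not_or]; exact ⟨hzy, hzU⟩⟩
      have hxZ : x ∉ gr ((N ／ ({y} : Set α)) ＼ ({x} : Set α)) \ U := by
        rw [hgr]
        intro h
        rw [mem_sdiff, mem_erase] at h
        exact h.1.1 rfl
      have hZg : gr ((N ／ ({y} : Set α)) ＼ ({x} : Set α)) \ U ⊆ gr N := by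
        rw [hgr]
        exact sdiff_subset.trans ((erase_subset x _).trans (erase_subset y _))
      have h1 := rk_minor_add_one (N := N) (x := y) (w := x) hy1
        (sdiff_subset : gr ((N ／ ({y} : Set α)) ＼ ({x} : Set α)) \ U ⊆ _)
      have h2 := rk_insert_eq_rk_insert_of_parallel hx hy hpar hpar' hZg
      rw [hcompl, h2, card_insert_of_notMem hxZ]
      omega
  · intro U hU U' hU' hUU'
    rw [mem_coe, mem_biIndepSets] at hU hU'
    have hyU : y ∉ U := by
      intro h
      have := hU.1 h
      rw [hgr, mem_erase, mem_erase] at this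
      exact this.2.1 rfl
    have hyU' : y ∉ U' := by
      intro h
      have := hU'.1 h
      rw [hgr, mem_erase, mem_erase] at this
      exact this.2.1 rfl
    have h : insert y U = insert y U' := hUU'
    rw [← erase_insert hyU, ← erase_insert hyU', h]

/-- **THE PARALLEL CLASS**: on ten points of rank `6`, `in_4(y) ≤ in_5(y)` at every point `y` parallel to a non-loop
`x ≠ y` — through the eight-point minor `N ／ y ∖ x` (rank `5`, nullity `3`) and Theorem A's step at nullity `3`. -/
theorem inCount_four_le_inCount_five_of_parallel (hn : (gr N).card = 10) (hR : rk N (gr N) = 6) {x y : α}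
    (hx : x ∈ gr N) (hy : y ∈ gr N) (hxy : x ≠ y) (hpar : x ∈ clF N {y}) (hx1 : rk N {x} = 1) :
    inCount N 4 y ≤ inCount N 5 y := by
  have hpar' : y ∈ clF N {x} := mem_clF_singleton_symm hx hy hx1 hpar
  have hy1 : rk N {y} = 1 := by
    have h1 := (mem_clF_iff_rk_insert_eq hx (singleton_subset_iff.2 hy)).1 hpar
    have h2 := rk_mono' (M := N) (singleton_subset_iff.2 (mem_insert_self x {y}))
    have h3 := rk_le_card (M := N) {y}
    rw [card_singleton] at h3
    omega
  have hgr := gr_minor_eq (N := N) y x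
  have hcard : (gr ((N ／ ({y} : Set α)) ＼ ({x} : Set α))).card = 8 := by
    rw [hgr, card_erase_of_mem (mem_erase.2 ⟨hxy, hx⟩), card_erase_of_mem hy, hn]
  have hrk : rk ((N ／ ({y} : Set α)) ＼ ({x} : Set α)) (gr ((N ／ ({y} : Set α)) ＼ ({x} : Set α))) = 5 := by
    have h1 := rk_minor_add_one (N := N) (x := y) (w := x) hy1 (subset_refl _)
    rw [insert_gr_minor_eq hy hxy] at h1
    have h2 : rk N ((gr N).erase x) = 6 := by
      have h3 := (mem_clF_iff_rk_insert_eq hx (erase_subset x (gr N))).1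
        (clF_mono (M := N) (singleton_subset_iff.2 (mem_erase.2 ⟨hxy.symm, hy⟩)) hpar)
      rw [insert_erase hx, hR] at h3
      exact h3.symm
    omega
  have hstep := biIndep_step_three_of_nullity_three (N := (N ／ ({y} : Set α)) ＼ ({x} : Set α))
    (by rw [hcard, hrk]) (by rw [hrk]; norm_num)
  rw [hcard] at hstep
  have h1 := inCount_four_le_biIndep_three_minor_of_parallel hx hy hxy hpar hpar' hy1
  have h2 := biIndep_four_minor_le_inCount_five_of_parallel hx hy hxy hpar hpar' hy1
  omega

end TenPointedA

end PercRepro.Cogirth
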